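import Summits.AnomalousDissipation.AnomalousDissipation.Theses.MomentParity
import Literature.Analysis.FluidPDE.StatisticalSolutionEnergyEq
import Literature.Analysis.FluidPDE.GalerkinFlow

/-!
# `ResolvedDissipation` (crux stmt-AnomalousDissipation-14284) — ideator-2 sketch, round 1

First lemmas of the three crux idea cards filed by `planner-cruxidea-stmt-AnomalousDissipation-14284-2-0`:

* card `enstrophy-ui-transfer`  — `resolved_of_uniformIntegrable_of_fgt`, `uniformIntegrable_of_resolved`
  (κ-resolution of the mean enstrophy, uniformly over a family of laws, is EQUIVALENT to uniform
  integrability of the enstrophy `‖∇u‖²` over the family, given the N-uniform Foias–Guillopé–Temam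
  mixed moment `∫ ‖Au‖²/(1+‖∇u‖²)² dμ ≤ C`);
* card `krylov-bogoliubov-window` — `lintegral_le_iSup_windowAverage` (abstract Krylov–Bogoliubov
  domination), `UniformTailDissipation` (C⁺_fin over the tree's `Torus.galerkinFlow`), transfer
  `resolvedDissipation_of_uniformTailDissipation`;
* card `lions-l4-domination`    — `energy_eq_of_fourthMoment` (the 3-D mean energy EQUALITY for a
  stationary statistical solution with finite fourth `L⁴`-moment: the tree's 2-D proof
  `Torus.IsStationaryStatisticalSolution.energy_eq_holds` with the Ladyzhenskaya domination replaced by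
  `|∫(u⊗u):∇Q_m u| ≤ ‖Q_m(u⊗u)‖₂ ‖∇Q_m u‖₂ ≤ ‖u‖₄² ‖∇u‖₂`), `tail_le_tensorTail` (the two-line flux
  inequality at level N) and the transfer `resolvedDissipation_of_uniformL4Moment` (C⁺ ⟹ crux).

Only `resolvedDissipation_iff` (faithful re-bundling of the crux's hypotheses) is proved; the rest are
`sorry`-stubs whose statements are the point (no skeleton at the ideate stage).
-/

noncomputable section

open MeasureTheory Filter Topology
open scoped ENNReal InnerProductSpace

namespace Summit.AnomalousDissipation.AnomalousDissipation.Cruxes.ResolvedDissipation.Ideate2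

open Literature.Analysis Literature.Analysis.FunctionSpaces Literature.Analysis.FluidPDE

/-- The flat 3-torus. -/
abbrev T3 : Type := UnitAddTorus (Fin 3)
/-- Velocity values. -/
abbrev R3 : Type := EuclideanSpace ℝ (Fin 3)
/-- The energy space `H = L²_σ(T³)` (mean zero, weakly divergence free). -/
abbrev H3 : Type := ↥(Torus.energySpace (Fin 3))

/-- `u ∈ H` is carried by the level-`N` Fourier–Galerkin fields (the crux's carrier clause). -/
def IsLevel (N : ℕ) (u : H3) : Prop :=
  ∀ k ∉ (Torus.freqBall N).erase (0 : Fin 3 → ℤ),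
    UnitAddTorus.mFourierCoeff (EuclideanSpace.complexify ∘ (u.1 : T3 → R3)) k = 0

/-- Band-limited smooth solenoidal mean-zero test field (the crux's test-field clause). -/
def IsBandTest (N : ℕ) (g : T3 → R3) : Prop :=
  Torus.IsSmooth g ∧ Torus.IsDivFree g ∧ Torus.HasZeroMean g ∧
    ∀ k ∉ (Torus.freqBall N).erase (0 : Fin 3 → ℤ),
      UnitAddTorus.mFourierCoeff (EuclideanSpace.complexify ∘ g) k = 0

/-- The differential `∑ᵢ ∂ᵢP((u,g₁),…,(u,gₘ)) gᵢ` of a polynomial cylindrical observable. -/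
def polyGrad {m : ℕ} (g : Fin m → T3 → R3) (P : MvPolynomial (Fin m) ℝ) (u : H3) : T3 → R3 :=
  fun x => ∑ i : Fin m,
    (MvPolynomial.eval (fun j => Torus.pairing u.1 (g j)) (MvPolynomial.pderiv i P)) • g i x

/-- The crux's four hypotheses on `μ`, bundled: a Borel probability measure on `H`, carried by the
level-`N` fields, supported in `‖u‖ ≤ R`, stationary for Galerkin NS at `(ν, f)` against every
polynomial cylindrical band-limited observable (= an invariant law of the level-`N` Galerkin system). -/
structure IsGalerkinInvariant (ν : ℝ) (f : T3 → R3) (N : ℕ) (R : ℝ) (μ : Measure H3) : Prop where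
  prob : IsProbabilityMeasure μ
  level : ∀ᵐ u ∂μ, IsLevel N u
  ball : ∀ᵐ u ∂μ, ‖u‖ ≤ R
  stationary : ∀ (m : ℕ) (g : Fin m → T3 → R3) (P : MvPolynomial (Fin m) ℝ),
    (∀ i, IsBandTest N (g i)) →
      Integrable (fun u => Torus.nsGeneratorPairing ν f u (polyGrad g P u)) μ ∧
        ∫ u, Torus.nsGeneratorPairing ν f u (polyGrad g P u) ∂μ = 0

/-- The crux's conclusion for one law: the mean enstrophy is `κ`-resolved. -/
def IsResolvedBy (κ : ℕ → ℕ) (μ : Measure H3) : Prop :=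
  ∀ n : ℕ, ∫⁻ u, Torus.eGradNormSq (u.1 : T3 → R3) ∂μ ≤
    (∫⁻ u, Torus.eGradNormSq (Torus.fourierTruncate (κ n) (u.1 : T3 → R3)) ∂μ) + ((n : ℝ≥0∞) + 1)⁻¹

/-- The re-bundling is faithful: the crux, verbatim, is "one schedule `κ(f, ν, R)` resolving every
Galerkin-invariant law at every level". -/
theorem resolvedDissipation_iff :
    Theses.MomentParity.ResolvedDissipation ↔
      ∀ f : T3 → R3, Torus.IsSmooth f → Torus.IsDivFree f → Torus.HasZeroMean f →
        ∀ ν : ℝ, 0 < ν → ∀ R : ℝ, ∃ κ : ℕ → ℕ, ∀ (N : ℕ) (μ : Measure H3),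
          IsGalerkinInvariant ν f N R μ → IsResolvedBy κ μ := by
  constructor
  · intro h f hf hd hz ν hν R
    obtain ⟨κ, hκ⟩ := h f hf hd hz ν hν R
    refine ⟨κ, fun N μ hμ => ?_⟩
    exact hκ N μ hμ.prob hμ.level hμ.ball hμ.stationary
  · intro h f hf hd hz ν hν R
    obtain ⟨κ, hκ⟩ := h f hf hd hz ν hν R
    exact ⟨κ, fun N μ hp hl hb hs => hκ N μ ⟨hp, hl, hb, hs⟩⟩

/-! ## Card `enstrophy-ui-transfer`: wavenumber tightness ⟺ amplitude tightness -/

/-- The spectral palinstrophy `‖Au‖₂² = 16π⁴ ∑_{k≠0} |k|⁴ ‖û(k)‖² ∈ [0,∞]`. -/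
def ePalNormSq (v : T3 → R3) : ℝ≥0∞ :=
  ENNReal.ofReal (16 * Real.pi ^ 4) * Torus.eHomSobolevSeminorm 2 (EuclideanSpace.complexify ∘ v) ^ 2

/-- Pointwise interpolation behind the transfer: the tail enstrophy beyond wavenumber `K` is at most
the palinstrophy divided by `4π²(K²+1)` (integrality of the lattice: `|k|² ≥ K²+1` off the ball). -/
theorem tailGradNormSq_le_ePalNormSq_div (K : ℕ) (v : T3 → R3) :
    Torus.tailGradNormSq K v ≤
      ePalNormSq v / ENNReal.ofReal (4 * Real.pi ^ 2 * ((K : ℝ) ^ 2 + 1)) := by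
  sorry

/-- **First lemma of card `enstrophy-ui-transfer` (⇐ direction).** Over ANY family `𝓕` of laws on `H`:
uniform integrability of the enstrophy + a uniform Foias–Guillopé–Temam mixed-moment bound
`∫ ‖Au‖²/(1+‖∇u‖²)² dμ ≤ C` give ONE resolution schedule `κ` for the whole family. (Split
`‖∇Q_K u‖² ≤ min(‖∇u‖², ‖Au‖²/(4π²(K²+1)))` on `{‖∇u‖² ≤ M}` / `{‖∇u‖² > M}`.) For
`𝓕 = ⋃_N Inv(N, R)` the FGT bound is the N-uniform stationarity identity of the observable
`−(1+‖∇u‖²)⁻¹` (card, §Lever), so the crux reduces to uniform integrability of `‖∇u‖²`. -/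
theorem resolved_of_uniformIntegrable_of_fgt (𝓕 : Set (Measure H3))
    (hprob : ∀ μ ∈ 𝓕, IsProbabilityMeasure μ)
    (hUI : ∀ ε : ℝ≥0∞, 0 < ε → ∃ M : ℝ≥0∞, M < ⊤ ∧ ∀ μ ∈ 𝓕,
      ∫⁻ u in {u : H3 | M < Torus.eGradNormSq (u.1 : T3 → R3)},
        Torus.eGradNormSq (u.1 : T3 → R3) ∂μ ≤ ε)
    (hFGT : ∃ C : ℝ≥0∞, C < ⊤ ∧ ∀ μ ∈ 𝓕,
      ∫⁻ u, ePalNormSq (u.1 : T3 → R3) / (1 + Torus.eGradNormSq (u.1 : T3 → R3)) ^ 2 ∂μ ≤ C) :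
    ∃ κ : ℕ → ℕ, ∀ μ ∈ 𝓕, IsResolvedBy κ μ := by
  sorry

/-- **Converse (⇒ direction):** on laws supported in the ball `‖u‖ ≤ R`, a common resolution
schedule forces uniform integrability of the enstrophy, because the resolved part is bounded:
`‖∇P_K u‖² ≤ 4π²K²‖u‖² ≤ 4π²K²R²`. Hence the crux is EQUIVALENT to uniform integrability of
`‖∇u‖²` over `⋃_N Inv(N, R)`. -/
theorem uniformIntegrable_of_resolved (𝓕 : Set (Measure H3)) (R : ℝ)
    (hprob : ∀ μ ∈ 𝓕, IsProbabilityMeasure μ) (hball : ∀ μ ∈ 𝓕, ∀ᵐ u ∂μ, ‖u‖ ≤ R)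
    (hfin : ∀ μ ∈ 𝓕, ∫⁻ u, Torus.eGradNormSq (u.1 : T3 → R3) ∂μ < ⊤)
    (hκ : ∃ κ : ℕ → ℕ, ∀ μ ∈ 𝓕, IsResolvedBy κ μ) :
    ∀ ε : ℝ≥0∞, 0 < ε → ∃ δ : ℝ≥0∞, 0 < δ ∧ ∀ μ ∈ 𝓕, ∀ A : Set H3, MeasurableSet A →
      μ A ≤ δ → ∫⁻ u in A, Torus.eGradNormSq (u.1 : T3 → R3) ∂μ ≤ ε := by
  sorry

/-! ## Card `lions-l4-domination`: the `L⁴` currency -/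

/-- **First lemma of card `lions-l4-domination`.** The 3-D mean energy EQUALITY for a stationary
statistical solution with finite fourth `L⁴` moment: in the tree's proof of the 2-D fact
`Torus.IsStationaryStatisticalSolution.energy_eq_holds` (Galerkin test `ψ(|P_m u|²)`, Liouville
equation, `m → ∞` by dominated convergence) replace step 4 by
`|∫ (u⊗u):∇P_m u| = |∫ Q_m(u⊗u):∇Q_m u| ≤ ‖Q_m(u ⊗ u)‖_{L²} ‖∇u‖_{L²} → 0` pointwise, dominated by
`‖u‖_{L⁴}² ‖∇u‖_{L²} ∈ L¹(μ)` (Cauchy–Schwarz of the two finite moments). In `d = 2` the hypothesis is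
automatic (Ladyzhenskaya `‖u‖₄² ≤ C|u|‖∇u‖`), which is why the printed theorem is two-dimensional;
this is the stationary-statistical form of Lions' `L⁴L⁴` energy-equality class. -/
theorem energy_eq_of_fourthMoment {ν : ℝ} {f : T3 → R3} {μ : Measure H3}
    (hμ : Torus.IsStationaryStatisticalSolution ν f μ) (hf : MemLp f 2 volume)
    (hL4 : ∫⁻ u, eLpNorm ((u.1 : T3 → R3)) 4 volume ^ 4 ∂μ < ⊤) :
    ν * (Torus.ensembleEnstrophy μ).toReal = ∫ u, Torus.pairing u.1 f ∂μ := by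
  sorry

/-- The mean-square `L²`-tail of the Reynolds-stress tensor `u ⊗ u` beyond wavenumber `K`:
`∑_{i,j} ∑_{|k|>K} |(uᵢuⱼ)^(k)|²`. -/
def tensorTailSq (K : ℕ) (v : T3 → R3) : ℝ≥0∞ :=
  ∑ i : Fin 3, ∑ j : Fin 3, ∑' k : {k : Fin 3 → ℤ // k ∉ Torus.freqBall K},
    ‖UnitAddTorus.mFourierCoeff (fun x => ((v x i * v x j : ℝ) : ℂ)) (k : Fin 3 → ℤ)‖ₑ ^ 2

/-- **Lemma 0 of card `lions-l4-domination` (the two-line flux inequality).** For an invariant law of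
the level-`N` Galerkin system and a force band-limited below `K`: the degree-2 stationarity identity of
the observable `‖Q_K u‖²` (`ν ∫‖∇Q_K u‖² dμ = ∫ Π_K dμ`, `Π_K(u) = −∫ (u⊗u):∇Q_K u`, only the
Fourier modes `|k| > K` of `u⊗u` pair with `∇Q_K u`) and Cauchy–Schwarz give
`∫ ‖∇Q_K u‖² dμ ≤ ν⁻² · 4π²… ∫ ‖Q_K(u⊗u)‖²_{L²} dμ` (constants folded into the `ofReal`). -/
theorem tail_le_tensorTail {ν : ℝ} (hν : 0 < ν) {f : T3 → R3} (hf : Torus.IsSmooth f)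
    {N : ℕ} {R : ℝ} {μ : Measure H3} (hμ : IsGalerkinInvariant ν f N R μ) (K : ℕ)
    (hfK : ∀ k ∉ Torus.freqBall K, UnitAddTorus.mFourierCoeff (EuclideanSpace.complexify ∘ f) k = 0) :
    ∫⁻ u, Torus.tailGradNormSq K (u.1 : T3 → R3) ∂μ ≤
      ENNReal.ofReal (4 * Real.pi ^ 2 * ν⁻¹ ^ 2) * ∫⁻ u, tensorTailSq K (u.1 : T3 → R3) ∂μ := by
  sorry

/-- **The transfer target C⁺ of card `lions-l4-domination`:** an N-UNIFORM bound on the fourth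
`L⁴`-moment over all invariant laws of the Galerkin systems in the ball of radius `R` (a single scalar
moment at the critical time-average scaling, the unique Shinbrot class there). -/
def UniformL4Moment : Prop :=
  ∀ f : T3 → R3, Torus.IsSmooth f → Torus.IsDivFree f → Torus.HasZeroMean f →
    ∀ ν : ℝ, 0 < ν → ∀ R : ℝ, ∃ C : ℝ≥0∞, C < ⊤ ∧ ∀ (N : ℕ) (μ : Measure H3),
      IsGalerkinInvariant ν f N R μ → ∫⁻ u, eLpNorm ((u.1 : T3 → R3)) 4 volume ^ 4 ∂μ ≤ C

/-- **Transfer (C⁺ ⟹ crux).** Route: a leaking sequence `(Nᵢ, μᵢ, Kᵢ)` (tail `≥ δ`) is tight in the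
STRONG topology of `H` (mean enstrophy `≤ |f|R/ν`); a subsequential limit `μ_∞` is a stationary
statistical solution (Liouville equation passes for cylindrical tests: `P_{Nᵢ}g → g`), has fourth
`L⁴` moment `≤ C` (lower semicontinuity), hence satisfies the mean energy equality
(`energy_eq_of_fourthMoment`), whereas `∫‖∇P_K u‖² dμ_∞ = limᵢ ∫‖∇P_K u‖² dμᵢ ≤ liminfᵢ ∫‖∇u‖² dμᵢ − δ`
for every `K` and `∫(f,u) dμ_∞ = lim ∫(f,u) dμᵢ = lim ν∫‖∇u‖² dμᵢ`: contradiction. -/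
theorem resolvedDissipation_of_uniformL4Moment :
    UniformL4Moment → Theses.MomentParity.ResolvedDissipation := by
  sorry

/-! ## Card `krylov-bogoliubov-window`: de-randomising the crux -/

/-- **First lemma of card `krylov-bogoliubov-window` (abstract Krylov–Bogoliubov domination).** An
invariant probability law is dominated, observable by observable, by the WORST finite-window time
average: `∫ g dμ = ∫ (T⁻¹∫₀ᵀ g∘φ_t dt) dμ ≤ sup_x T⁻¹∫₀ᵀ g(φ_t x) dt` (Fubini + invariance). -/
theorem lintegral_le_iSup_windowAverage {X : Type*} [MeasurableSpace X] (μ : Measure X)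
    [IsProbabilityMeasure μ] (φ : ℝ → X → X)
    (hmeas : Measurable (fun p : ℝ × X => φ p.1 p.2))
    (hinv : ∀ t, 0 ≤ t → Measure.map (φ t) μ = μ)
    (g : X → ℝ≥0∞) (hg : Measurable g) {T : ℝ} (hT : 0 < T) :
    ∫⁻ x, g x ∂μ ≤ ⨆ x, (ENNReal.ofReal T)⁻¹ * ∫⁻ t in Set.Ioo 0 T, g (φ t x) := by
  sorry

/-- The level-`N` Galerkin semiflow of the tree (`Torus.galerkinFlow`, on fields) read on `H`
through the canonical trigonometric-polynomial representative `P_N u` of a level-`N` class. -/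
def levelFlow (ν : ℝ) (f : T3 → R3) (N : ℕ) (t : ℝ) (u : H3) : T3 → R3 :=
  Torus.galerkinFlow ν f N t (Torus.fourierTruncate N (u.1 : T3 → R3))

/-- **The transfer target C⁺_fin of card `krylov-bogoliubov-window`** (deterministic, finite
window, no measures): for every `(f, ν, R, η)` ONE wavenumber `K` and ONE constant `C₀` such that
EVERY Galerkin trajectory of EVERY order `N` issued from a mean-zero Galerkin mode in the `L²`-ball of
radius `R` dissipates, beyond wavenumber `K`, at most `ηT + C₀` on `[0, T]`, for every `T ≥ 0`
(one-off transients and even one-off near-singular events are allowed — `C₀` — but no sustained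
tail production at a positive rate). -/
def UniformTailDissipation : Prop :=
  ∀ f : T3 → R3, Torus.IsSmooth f → Torus.IsDivFree f → Torus.HasZeroMean f →
    ∀ ν : ℝ, 0 < ν → ∀ R : ℝ, ∀ η : ℝ, 0 < η → ∃ (K : ℕ) (C₀ : ℝ), ∀ (N : ℕ) (a : T3 → R3),
      IsGalerkinMode N a → Torus.HasZeroMean a → (∫ x, ‖a x‖ ^ 2) ≤ R ^ 2 →
        ∀ T : ℝ, 0 ≤ T →
          ν * (∫⁻ t in Set.Ioo 0 T, Torus.tailGradNormSq K (Torus.galerkinFlow ν f N t a)).toReal ≤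
            η * T + C₀

/-- **Bookkeeping fact the transfer needs** (Liouville ⟹ invariance on the compact level-`N`
carrier): for a law satisfying the crux's hypotheses, the law of the tail enstrophy is invariant
under the level-`N` Galerkin semiflow, jointly measurably in `(t, u)`. -/
def TailFlowInvariance : Prop :=
  ∀ (ν : ℝ) (f : T3 → R3) (N : ℕ) (R : ℝ) (μ : Measure H3), 0 < ν →
    Torus.IsSmooth f → Torus.IsDivFree f → Torus.HasZeroMean f →
      IsGalerkinInvariant ν f N R μ → ∀ (K : ℕ),
        Measurable (fun p : ℝ × H3 => Torus.tailGradNormSq K (levelFlow ν f N p.1 p.2)) ∧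
          ∀ t : ℝ, 0 ≤ t →
            ∫⁻ u, Torus.tailGradNormSq K (u.1 : T3 → R3) ∂μ =
              ∫⁻ u, Torus.tailGradNormSq K (levelFlow ν f N t u) ∂μ

/-- **Transfer (C⁺_fin ⟹ crux).** `ν ∫ tail_K dμ = ν ∫ (T⁻¹∫₀ᵀ tail_K ∘ flow) dμ ≤ (ηT + C₀)/T → η`
(`lintegral_le_iSup_windowAverage` with `TailFlowInvariance`; the level-`N` carrier makes
`P_N u = u` a.e., a mean-zero Galerkin mode in the ball), then `κ(n) := K(η = ν/(n+1))` and
`‖∇u‖² = ‖∇P_K u‖² + tail_K`. -/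
theorem resolvedDissipation_of_uniformTailDissipation :
    UniformTailDissipation → TailFlowInvariance → Theses.MomentParity.ResolvedDissipation := by
  sorry

end Summit.AnomalousDissipation.AnomalousDissipation.Cruxes.ResolvedDissipation.Ideate2

end
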